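import Mathlib
import Literature.MathematicalPhysics.StatisticalMechanics.MuGroundStateConfiguration
import Literature.Geometry.DiscreteGeometry.KissingPatterns
import Literature.Probability.Process.PointStationaryLaw

/-!
# FrustratedLawDichotomy · crux `AperiodicFrustratedLawGap` (stmt-AtomisticToContinuum-27623) — THE ONE-ATOM TESTS OF THE SURGERY CURRENCY,
# EXACT, AND THE NASH BINDER OF THE RESIDUAL IS IDLE (route-independent module; decomp-a2c, prover hand 2, structural share, generation 5)

The `n + k ≤ 2` instances of Sütő's μGSC property (`Literature…IsMuGSC`, second form), at configuration level and WITHOUT the `½R`-corrections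
that the law-level one-atom floors of generation 4 carry:

* `binding_le_of_isMuGSC`  (`n = 1, k = 0`): every atom `p` of a `μ`GSC `X` has one-particle energy `Σ'_{q ∈ X∖{p}} V(dist p q) ≤ μ`;
* `field_ge_of_isMuGSC`    (`n = 0, k = 1`): every vacant site `z ∉ X` has field `Σ'_{q ∈ X} V(dist z q) ≥ μ`;
* `nash_of_isMuGSC`        (`n = k = 1`): no single atom can be moved (off the other atoms) to lower its interaction with the rest — the crux's
  Nash clause (e), at set level and, `nash_clause_of_isMuGSC`, in the crux's own measure-level vocabulary verbatim.

Consequence for the law-free residuals of `FrustratedLawDichotomyAperiodicGapGSCDoor`: the Nash binder is IDLE —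
`rGSC_iff_noNash` / `rGSCaper_iff_noNash`: `R_GSC` («no rooted hard-core textured Nash `e⋆`-μGSC») is equivalent to «no rooted hard-core textured
`e⋆`-μGSC».  So the open core of item 27623 in surgery currency reads: NO ROOTED `7/10`-HARD-CORE CONFIGURATION OF `ℝ³` THAT IS
TEXTURE-APPROACHABLE AT EVERY ATOM (and not a periodic translate) IS AN `e⋆`-μ-GROUND-STATE CONFIGURATION OF LENNARD-JONES.
All `[folklore]` given Sütő's definition [cite: Suto2006, §2 Definition].
-/

noncomputable section

namespace Summit.AtomisticToContinuum.Crystallization.Theorems.FrustratedLawDichotomyGSCOneAtomTests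

open Literature.MathematicalPhysics.StatisticalMechanics

/-! ## §1. One-atom tests of a `μ`GSC (any potential, any `μ`, any dimension) -/

section General

variable {d : ℕ} {V : ℝ → ℝ} {μ : ℝ} {X : Set (EuclideanSpace ℝ (Fin d))}

/-- The one-point configuration at `p` is injective and has range `{p}`. [folklore] -/
theorem range_const_fin_one (p : EuclideanSpace ℝ (Fin d)) : Set.range (fun _ : Fin 1 => p) = {p} :=
  Set.range_const

/-- **BINDING TEST** (`n = 1`, `k = 0`): in a `μ`GSC every atom is bound by at least `|μ|`: `Σ'_{q ∈ X ∖ {p}} V(dist p q) ≤ μ`.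
[cite: Suto2006, §2 Definition (μGSC), removal of one point] -/
theorem binding_le_of_isMuGSC (h : IsMuGSC V μ X) {p : EuclideanSpace ℝ (Fin d)} (hp : p ∈ X) :
    ∑' q : ↥(X \ {p}), V (dist p q) ≤ μ := by
  have hxf : Function.Injective (fun _ : Fin 1 => p) := Function.injective_of_subsingleton _
  have hX : Set.range (fun _ : Fin 1 => p) ⊆ X := by
    rw [range_const_fin_one]; exact Set.singleton_subset_iff.2 hp
  have hR : Function.Injective (fun i : Fin 0 => (i.elim0 : EuclideanSpace ℝ (Fin d))) := fun i => i.elim0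
  have hdisj : Disjoint (Set.range (fun i : Fin 0 => (i.elim0 : EuclideanSpace ℝ (Fin d)))) (X \ Set.range (fun _ : Fin 1 => p)) := by
    rw [Set.range_eq_empty]; exact Set.empty_disjoint _
  have key := h.le hxf hX hR hdisj
  have h0 : interactionEnergy V (fun i : Fin 0 => (i.elim0 : EuclideanSpace ℝ (Fin d))) = 0 := interactionEnergy_of_subsingleton V _
  have h1 : interactionEnergy V (fun _ : Fin 1 => p) = 0 := interactionEnergy_of_subsingleton V _
  rw [h0, h1, Fin.sum_univ_one, Finset.sum_of_isEmpty] at key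
  have hs : X \ Set.range (fun _ : Fin 1 => p) = X \ {p} := by rw [range_const_fin_one]
  rw [tsum_congr_set_coe (fun q => V (dist p q)) hs] at key
  simp only [Nat.cast_one, Nat.cast_zero, mul_one, mul_zero, zero_add, sub_zero] at key
  linarith

/-- **VACANCY (FIELD) TEST** (`n = 0`, `k = 1`): in a `μ`GSC every vacant site `z ∉ X` has field `Σ'_{q ∈ X} V(dist z q) ≥ μ` (inserting
one atom never pays). [cite: Suto2006, §2 Definition (μGSC), insertion of one point] -/
theorem field_ge_of_isMuGSC (h : IsMuGSC V μ X) {z : EuclideanSpace ℝ (Fin d)} (hz : z ∉ X) :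
    μ ≤ ∑' q : ↥X, V (dist z q) := by
  have hxf : Function.Injective (fun i : Fin 0 => (i.elim0 : EuclideanSpace ℝ (Fin d))) := fun i => i.elim0
  have hX : Set.range (fun i : Fin 0 => (i.elim0 : EuclideanSpace ℝ (Fin d))) ⊆ X := by
    rw [Set.range_eq_empty]; exact Set.empty_subset _
  have hR : Function.Injective (fun _ : Fin 1 => z) := Function.injective_of_subsingleton _
  have hs : X \ Set.range (fun i : Fin 0 => (i.elim0 : EuclideanSpace ℝ (Fin d))) = X := by
    rw [Set.range_eq_empty, Set.sdiff_empty]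
  have hdisj : Disjoint (Set.range (fun _ : Fin 1 => z)) (X \ Set.range (fun i : Fin 0 => (i.elim0 : EuclideanSpace ℝ (Fin d)))) := by
    rw [range_const_fin_one, hs, Set.disjoint_singleton_left]; exact hz
  have key := h.le hxf hX hR hdisj
  have h0 : interactionEnergy V (fun i : Fin 0 => (i.elim0 : EuclideanSpace ℝ (Fin d))) = 0 := interactionEnergy_of_subsingleton V _
  have h1 : interactionEnergy V (fun _ : Fin 1 => z) = 0 := interactionEnergy_of_subsingleton V _
  rw [h0, h1, Fin.sum_univ_one, Finset.sum_of_isEmpty] at key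
  rw [tsum_congr_set_coe (fun q => V (dist z q)) hs] at key
  simp only [Nat.cast_one, Nat.cast_zero, mul_one, mul_zero, zero_add, sub_zero] at key
  linarith

/-- **NASH TEST** (`n = k = 1`): in a `μ`GSC no atom `p` can be moved to a site `y` off the other atoms so as to lower its interaction with
the rest: `Σ'_{q ∈ X∖{p}} V(dist p q) ≤ Σ'_{q ∈ X∖{p}} V(dist y q)`; the chemical potential cancels.
[cite: Suto2006, §2 Definition (μGSC), one-point exchange] -/
theorem nash_of_isMuGSC (h : IsMuGSC V μ X) {p : EuclideanSpace ℝ (Fin d)} (hp : p ∈ X)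
    (y : EuclideanSpace ℝ (Fin d)) (hy : ∀ q ∈ X, q ≠ p → y ≠ q) :
    ∑' q : ↥(X \ {p}), V (dist p q) ≤ ∑' q : ↥(X \ {p}), V (dist y q) := by
  have hxf : Function.Injective (fun _ : Fin 1 => p) := Function.injective_of_subsingleton _
  have hX : Set.range (fun _ : Fin 1 => p) ⊆ X := by
    rw [range_const_fin_one]; exact Set.singleton_subset_iff.2 hp
  have hR : Function.Injective (fun _ : Fin 1 => y) := Function.injective_of_subsingleton _
  have hs : X \ Set.range (fun _ : Fin 1 => p) = X \ {p} := by rw [range_const_fin_one]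
  have hdisj : Disjoint (Set.range (fun _ : Fin 1 => y)) (X \ Set.range (fun _ : Fin 1 => p)) := by
    rw [range_const_fin_one, hs, Set.disjoint_singleton_left]
    rintro ⟨hyX, hyp⟩
    exact hy y hyX (fun h' => hyp (Set.mem_singleton_iff.2 h')) rfl
  have key := h.le hxf hX hR hdisj
  have h1 : interactionEnergy V (fun _ : Fin 1 => p) = 0 := interactionEnergy_of_subsingleton V _
  have h2 : interactionEnergy V (fun _ : Fin 1 => y) = 0 := interactionEnergy_of_subsingleton V _
  rw [h1, h2, Fin.sum_univ_one, Fin.sum_univ_one] at key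
  rw [tsum_congr_set_coe (fun q => V (dist p q)) hs, tsum_congr_set_coe (fun q => V (dist y q)) hs] at key
  linarith

end General

/-! ## §2. The crux's Nash clause, verbatim, from the μGSC property of the atom set -/

/-- The atom set of `μ` minus `p`, as the subtype the crux's Nash clause sums over. [folklore] -/
theorem atoms_diff_singleton (μ : MeasureTheory.Measure (EuclideanSpace ℝ (Fin 3))) (p : EuclideanSpace ℝ (Fin 3)) :
    {p' : EuclideanSpace ℝ (Fin 3) | μ {p'} ≠ 0} \ {p} = {q : EuclideanSpace ℝ (Fin 3) | μ {q} ≠ 0 ∧ q ≠ p} := by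
  ext q; simp only [Set.mem_sdiff, Set.mem_setOf_eq, Set.mem_singleton_iff, ne_eq]

/-- **The crux's Nash clause (e) follows from the μGSC property of the atom set** (any chemical potential `μc`), in the crux's measure-level
vocabulary verbatim. [folklore] -/
theorem nash_clause_of_isMuGSC {μc : ℝ} {μ : MeasureTheory.Measure (EuclideanSpace ℝ (Fin 3))}
    (h : IsMuGSC lennardJones μc {p : EuclideanSpace ℝ (Fin 3) | μ {p} ≠ 0}) :
    ∀ p : EuclideanSpace ℝ (Fin 3), μ {p} ≠ 0 → ∀ y : EuclideanSpace ℝ (Fin 3), (∀ q : EuclideanSpace ℝ (Fin 3), μ {q} ≠ 0 → q ≠ p → y ≠ q) → ∑' q : {q : EuclideanSpace ℝ (Fin 3) // μ {q} ≠ 0 ∧ q ≠ p}, Literature.MathematicalPhysics.StatisticalMechanics.lennardJones (dist p (q : EuclideanSpace ℝ (Fin 3))) ≤ ∑' q : {q : EuclideanSpace ℝ (Fin 3) // μ {q} ≠ 0 ∧ q ≠ p}, Literature.MathematicalPhysics.StatisticalMechanics.lennardJones (dist y (q : EuclideanSpace ℝ (Fin 3))) := by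
  intro p hp y hy
  have key := nash_of_isMuGSC h (show p ∈ {p' : EuclideanSpace ℝ (Fin 3) | μ {p'} ≠ 0} from hp) y (fun q hq hqp => hy q hq hqp)
  rw [tsum_congr_set_coe (fun q => lennardJones (dist p q)) (atoms_diff_singleton μ p),
    tsum_congr_set_coe (fun q => lennardJones (dist y q)) (atoms_diff_singleton μ p)] at key
  exact key

/-! ## §3. The Nash binder of the residuals is idle -/

/-- **`R_GSC` ↔ `R_GSC` WITHOUT THE NASH BINDER**: since an `e⋆`-μGSC atom set makes the configuration Nash (`nash_clause_of_isMuGSC`), the residual «no rooted hard-core textured Nash `e⋆`-μGSC» is the same statement as «no rooted hard-core textured `e⋆`-μGSC». [folklore] -/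
theorem rGSC_iff_noNash :
    (∀ δ : ℝ, 0 < δ → ∀ R₇ R₈ R₉ : ℝ, ∀ μ : MeasureTheory.Measure (EuclideanSpace ℝ (Fin 3)), let Gy : ℝ → (N : ℕ) → (Fin N → EuclideanSpace ℝ (Fin 3)) → Fin N → Prop := fun η N y j => let d : ℝ := sInf ((fun z => dist z (y (j : Fin N))) '' (Set.range (y) \ {(y (j : Fin N))})); let T : Set (EuclideanSpace ℝ (Fin 3)) := {z : EuclideanSpace ℝ (Fin 3) | z ∈ Set.range (y) ∧ z ≠ (y (j : Fin N)) ∧ dist z (y (j : Fin N)) < 13 / 10 * d}; ∃ A : EuclideanSpace ℝ (Fin 3) →ₗᵢ[ℝ] EuclideanSpace ℝ (Fin 3), (∃ e : ↥T ≃ ↥Literature.Geometry.DiscreteGeometry.fccKissingPattern, ∀ t : ↥T, dist (d⁻¹ • ((t : EuclideanSpace ℝ (Fin 3)) - (y (j : Fin N)))) (A ((e t : ↥Literature.Geometry.DiscreteGeometry.fccKissingPattern) : EuclideanSpace ℝ (Fin 3))) ≤ η) ∨ (∃ e : ↥T ≃ ↥Literature.Geometry.DiscreteGeometry.hcpKissingPattern,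 ∀ t : ↥T, dist (d⁻¹ • ((t : EuclideanSpace ℝ (Fin 3)) - (y (j : Fin N)))) (A ((e t : ↥Literature.Geometry.DiscreteGeometry.hcpKissingPattern) : EuclideanSpace ℝ (Fin 3))) ≤ η); let TexBall : (N : ℕ) → (Fin N → EuclideanSpace ℝ (Fin 3)) → Fin N → ℝ → ℝ → ℝ → ℝ → Prop := fun N y i R R₇ R₈ R₉ => (∀ a b : Fin N, a ≠ b → (7 : ℝ) / 10 ≤ dist (y a) (y b)) ∧ (∀ j : Fin N, dist (y j) (y i) ≤ R → ¬ Gy (1 / 20) N (y) j) ∧ (∀ j : Fin N, dist (y j) (y i) ≤ R → ¬ ((∀ j' : Fin N, dist (y j') (y j) ≤ R₇ → ¬ Gy (1 / 20) N (y) j') ∧ (∀ z : EuclideanSpace ℝ (Fin 3), dist z (y j) ≤ R₇ → ∃ k : Fin N, dist z (y k) ≤ 1) ∧ (∀ j' : Fin N, dist (y j') (y j) ≤ R₇ → (let d : ℝ := sInf ((fun z => dist z (y j')) '' (Set.range (y) \ {(y j')})); ∀ k : Fin N, y k ≠ y j' → dist (y k) (y j') < 27 / 20 * d → 5 ≤ Nat.card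 {m : Fin N // y m ≠ y j' ∧ dist (y m) (y j') < 27 / 20 * d ∧ y m ≠ y k ∧ dist (y m) (y k) < 27 / 20 * d})))) ∧ (∀ j : Fin N, dist (y j) (y i) ≤ R → ∃ k : Fin N, dist (y k) (y j) ≤ R₈ ∧ Gy (1 / 8) N (y) k) ∧ (∀ j : Fin N, dist (y j) (y i) ≤ R → ¬ ((∀ j' : Fin N, dist (y j') (y j) ≤ R₉ → ¬ Gy (1 / 20) N (y) j') ∧ (Nat.card {j' : Fin N // dist (y j') (y j) ≤ R₉ ∧ ¬ Gy (1 / 8) N (y) j'} : ℝ) ≤ 1 / 2 * (Nat.card {j' : Fin N // dist (y j') (y j) ≤ R₉} : ℝ) ∧ (∀ j' : Fin N, dist (y j') (y j) ≤ R₉ → ¬ Gy (1 / 8) N (y) j' → ¬ (let d : ℝ := sInf ((fun z => dist z (y j')) '' (Set.range (y) \ {(y j')})); ∀ k : Fin N, y k ≠ y j' → dist (y k) (y j') < 27 / 20 * d → 5 ≤ Nat.card {m : Fin N // y m ≠ y j' ∧ dist (y m) (y j') < 27 / 20 * d ∧ y m ≠ y k ∧ dist (y m) (y k) < 27 / 20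 * d})))); let Appr : MeasureTheory.Measure (EuclideanSpace ℝ (Fin 3)) → ℝ → ℝ → ℝ → Prop := fun μ R₇ R₈ R₉ => ∀ q : EuclideanSpace ℝ (Fin 3), μ {q} ≠ 0 → ∀ R ε : ℝ, 0 < ε → ∃ (N : ℕ) (y : Fin N → EuclideanSpace ℝ (Fin 3)) (i : Fin N), TexBall N y i R R₇ R₈ R₉ ∧ (∀ p : EuclideanSpace ℝ (Fin 3), μ {p} ≠ 0 → dist p q ≤ R → ∃ k : Fin N, dist (y k - y i) (p - q) ≤ ε) ∧ (∀ k : Fin N, dist (y k) (y i) ≤ R → ∃ p : EuclideanSpace ℝ (Fin 3), μ {p} ≠ 0 ∧ dist (y k - y i) (p - q) ≤ ε); Literature.Probability.Process.IsRootedHardCore δ μ → Appr μ R₇ R₈ R₉ → (∀ p : EuclideanSpace ℝ (Fin 3), μ {p} ≠ 0 → ∀ y : EuclideanSpace ℝ (Fin 3), (∀ q : EuclideanSpace ℝ (Fin 3), μ {q} ≠ 0 → q ≠ p → y ≠ q) → ∑' q : {q : EuclideanSpace ℝ (Fin 3) // μ {q} ≠ 0 ∧ q ≠ p}, Literature.MathematicalPhysics.StatisticalMechanics.lennardJones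 (dist p (q : EuclideanSpace ℝ (Fin 3))) ≤ ∑' q : {q : EuclideanSpace ℝ (Fin 3) // μ {q} ≠ 0 ∧ q ≠ p}, Literature.MathematicalPhysics.StatisticalMechanics.lennardJones (dist y (q : EuclideanSpace ℝ (Fin 3)))) → ¬ Literature.MathematicalPhysics.StatisticalMechanics.IsMuGSC Literature.MathematicalPhysics.StatisticalMechanics.lennardJones (⨅ Q : Literature.MathematicalPhysics.StatisticalMechanics.PeriodicConfiguration 3, Q.energyPerParticle Literature.MathematicalPhysics.StatisticalMechanics.lennardJones) {p : EuclideanSpace ℝ (Fin 3) | μ {p} ≠ 0}) ↔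
    (∀ δ : ℝ, 0 < δ → ∀ R₇ R₈ R₉ : ℝ, ∀ μ : MeasureTheory.Measure (EuclideanSpace ℝ (Fin 3)), let Gy : ℝ → (N : ℕ) → (Fin N → EuclideanSpace ℝ (Fin 3)) → Fin N → Prop := fun η N y j => let d : ℝ := sInf ((fun z => dist z (y (j : Fin N))) '' (Set.range (y) \ {(y (j : Fin N))})); let T : Set (EuclideanSpace ℝ (Fin 3)) := {z : EuclideanSpace ℝ (Fin 3) | z ∈ Set.range (y) ∧ z ≠ (y (j : Fin N)) ∧ dist z (y (j : Fin N)) < 13 / 10 * d}; ∃ A : EuclideanSpace ℝ (Fin 3) →ₗᵢ[ℝ] EuclideanSpace ℝ (Fin 3), (∃ e : ↥T ≃ ↥Literature.Geometry.DiscreteGeometry.fccKissingPattern, ∀ t : ↥T, dist (d⁻¹ • ((t : EuclideanSpace ℝ (Fin 3)) - (y (j : Fin N)))) (A ((e t : ↥Literature.Geometry.DiscreteGeometry.fccKissingPattern) : EuclideanSpace ℝ (Fin 3))) ≤ η) ∨ (∃ e : ↥T ≃ ↥Literature.Geometry.DiscreteGeometry.hcpKissingPattern, ∀ t : ↥T,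 dist (d⁻¹ • ((t : EuclideanSpace ℝ (Fin 3)) - (y (j : Fin N)))) (A ((e t : ↥Literature.Geometry.DiscreteGeometry.hcpKissingPattern) : EuclideanSpace ℝ (Fin 3))) ≤ η); let TexBall : (N : ℕ) → (Fin N → EuclideanSpace ℝ (Fin 3)) → Fin N → ℝ → ℝ → ℝ → ℝ → Prop := fun N y i R R₇ R₈ R₉ => (∀ a b : Fin N, a ≠ b → (7 : ℝ) / 10 ≤ dist (y a) (y b)) ∧ (∀ j : Fin N, dist (y j) (y i) ≤ R → ¬ Gy (1 / 20) N (y) j) ∧ (∀ j : Fin N, dist (y j) (y i) ≤ R → ¬ ((∀ j' : Fin N, dist (y j') (y j) ≤ R₇ → ¬ Gy (1 / 20) N (y) j') ∧ (∀ z : EuclideanSpace ℝ (Fin 3), dist z (y j) ≤ R₇ → ∃ k : Fin N, dist z (y k) ≤ 1) ∧ (∀ j' : Fin N, dist (y j') (y j) ≤ R₇ → (let d : ℝ := sInf ((fun z => dist z (y j')) '' (Set.range (y) \ {(y j')})); ∀ k : Fin N, y k ≠ y j' → dist (y k) (y j') < 27 / 20 * d → 5 ≤ Nat.card {m : Fin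 N // y m ≠ y j' ∧ dist (y m) (y j') < 27 / 20 * d ∧ y m ≠ y k ∧ dist (y m) (y k) < 27 / 20 * d})))) ∧ (∀ j : Fin N, dist (y j) (y i) ≤ R → ∃ k : Fin N, dist (y k) (y j) ≤ R₈ ∧ Gy (1 / 8) N (y) k) ∧ (∀ j : Fin N, dist (y j) (y i) ≤ R → ¬ ((∀ j' : Fin N, dist (y j') (y j) ≤ R₉ → ¬ Gy (1 / 20) N (y) j') ∧ (Nat.card {j' : Fin N // dist (y j') (y j) ≤ R₉ ∧ ¬ Gy (1 / 8) N (y) j'} : ℝ) ≤ 1 / 2 * (Nat.card {j' : Fin N // dist (y j') (y j) ≤ R₉} : ℝ) ∧ (∀ j' : Fin N, dist (y j') (y j) ≤ R₉ → ¬ Gy (1 / 8) N (y) j' → ¬ (let d : ℝ := sInf ((fun z => dist z (y j')) '' (Set.range (y) \ {(y j')})); ∀ k : Fin N, y k ≠ y j' → dist (y k) (y j') < 27 / 20 * d → 5 ≤ Nat.card {m : Fin N // y m ≠ y j' ∧ dist (y m) (y j') < 27 / 20 * d ∧ y m ≠ y k ∧ dist (y m) (y k) < 27 / 20 * d}))));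 let Appr : MeasureTheory.Measure (EuclideanSpace ℝ (Fin 3)) → ℝ → ℝ → ℝ → Prop := fun μ R₇ R₈ R₉ => ∀ q : EuclideanSpace ℝ (Fin 3), μ {q} ≠ 0 → ∀ R ε : ℝ, 0 < ε → ∃ (N : ℕ) (y : Fin N → EuclideanSpace ℝ (Fin 3)) (i : Fin N), TexBall N y i R R₇ R₈ R₉ ∧ (∀ p : EuclideanSpace ℝ (Fin 3), μ {p} ≠ 0 → dist p q ≤ R → ∃ k : Fin N, dist (y k - y i) (p - q) ≤ ε) ∧ (∀ k : Fin N, dist (y k) (y i) ≤ R → ∃ p : EuclideanSpace ℝ (Fin 3), μ {p} ≠ 0 ∧ dist (y k - y i) (p - q) ≤ ε); Literature.Probability.Process.IsRootedHardCore δ μ → Appr μ R₇ R₈ R₉ → ¬ Literature.MathematicalPhysics.StatisticalMechanics.IsMuGSC Literature.MathematicalPhysics.StatisticalMechanics.lennardJones (⨅ Q : Literature.MathematicalPhysics.StatisticalMechanics.PeriodicConfiguration 3, Q.energyPerParticle Literature.MathematicalPhysics.StatisticalMechanics.lennardJones) {p : EuclideanSpace ℝ (Fin 3) | μ {p} ≠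 0}) := by
  constructor
  · intro hR δ hδ R₇ R₈ R₉ μ
    have h' := hR δ hδ R₇ R₈ R₉ μ
    dsimp only at h' ⊢
    intro hcore happr hG
    exact h' hcore happr (nash_clause_of_isMuGSC hG) hG
  · intro hR δ hδ R₇ R₈ R₉ μ
    have h' := hR δ hδ R₇ R₈ R₉ μ
    dsimp only at h' ⊢
    intro hcore happr _hnash
    exact h' hcore happr

/-- The same for the aperiodic residual `R_GSC^aper`. [folklore] -/
theorem rGSCaper_iff_noNash :
    (∀ δ : ℝ, 0 < δ → ∀ R₇ R₈ R₉ : ℝ, ∀ μ : MeasureTheory.Measure (EuclideanSpace ℝ (Fin 3)), let Gy : ℝ → (N : ℕ) → (Fin N → EuclideanSpace ℝ (Fin 3)) → Fin N → Prop := fun η N y j => let d : ℝ := sInf ((fun z => dist z (y (j : Fin N))) '' (Set.range (y) \ {(y (j : Fin N))})); let T : Set (EuclideanSpace ℝ (Fin 3)) := {z : EuclideanSpace ℝ (Fin 3) | z ∈ Set.range (y) ∧ z ≠ (y (j : Fin N)) ∧ dist z (y (j : Fin N)) < 13 / 10 * d}; ∃ A : EuclideanSpace ℝ (Fin 3) →ₗᵢ[ℝ]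 EuclideanSpace ℝ (Fin 3), (∃ e : ↥T ≃ ↥Literature.Geometry.DiscreteGeometry.fccKissingPattern, ∀ t : ↥T, dist (d⁻¹ • ((t : EuclideanSpace ℝ (Fin 3)) - (y (j : Fin N)))) (A ((e t : ↥Literature.Geometry.DiscreteGeometry.fccKissingPattern) : EuclideanSpace ℝ (Fin 3))) ≤ η) ∨ (∃ e : ↥T ≃ ↥Literature.Geometry.DiscreteGeometry.hcpKissingPattern, ∀ t : ↥T, dist (d⁻¹ • ((t : EuclideanSpace ℝ (Fin 3)) - (y (j : Fin N)))) (A ((e t : ↥Literature.Geometry.DiscreteGeometry.hcpKissingPattern) : EuclideanSpace ℝ (Fin 3))) ≤ η); let TexBall : (N : ℕ) → (Fin N → EuclideanSpace ℝ (Fin 3)) → Fin N → ℝ → ℝ → ℝ → ℝ → Prop := fun N y i R R₇ R₈ R₉ => (∀ a b : Fin N, a ≠ b → (7 : ℝ) / 10 ≤ dist (y a) (y b)) ∧ (∀ j : Fin N, dist (y j) (y i) ≤ R → ¬ Gy (1 / 20) N (y) j) ∧ (∀ j : Fin N, dist (y j) (y i) ≤ R → ¬ ((∀ j' : Fin N,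 dist (y j') (y j) ≤ R₇ → ¬ Gy (1 / 20) N (y) j') ∧ (∀ z : EuclideanSpace ℝ (Fin 3), dist z (y j) ≤ R₇ → ∃ k : Fin N, dist z (y k) ≤ 1) ∧ (∀ j' : Fin N, dist (y j') (y j) ≤ R₇ → (let d : ℝ := sInf ((fun z => dist z (y j')) '' (Set.range (y) \ {(y j')})); ∀ k : Fin N, y k ≠ y j' → dist (y k) (y j') < 27 / 20 * d → 5 ≤ Nat.card {m : Fin N // y m ≠ y j' ∧ dist (y m) (y j') < 27 / 20 * d ∧ y m ≠ y k ∧ dist (y m) (y k) < 27 / 20 * d})))) ∧ (∀ j : Fin N, dist (y j) (y i) ≤ R → ∃ k : Fin N, dist (y k) (y j) ≤ R₈ ∧ Gy (1 / 8) N (y) k) ∧ (∀ j : Fin N, dist (y j) (y i) ≤ R → ¬ ((∀ j' : Fin N, dist (y j') (y j) ≤ R₉ → ¬ Gy (1 / 20) N (y) j') ∧ (Nat.card {j' : Fin N // dist (y j') (y j) ≤ R₉ ∧ ¬ Gy (1 / 8) N (y) j'} : ℝ) ≤ 1 / 2 * (Nat.card {j' : Fin N // dist (y j') (y j) ≤ R₉}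 : ℝ) ∧ (∀ j' : Fin N, dist (y j') (y j) ≤ R₉ → ¬ Gy (1 / 8) N (y) j' → ¬ (let d : ℝ := sInf ((fun z => dist z (y j')) '' (Set.range (y) \ {(y j')})); ∀ k : Fin N, y k ≠ y j' → dist (y k) (y j') < 27 / 20 * d → 5 ≤ Nat.card {m : Fin N // y m ≠ y j' ∧ dist (y m) (y j') < 27 / 20 * d ∧ y m ≠ y k ∧ dist (y m) (y k) < 27 / 20 * d})))); let Appr : MeasureTheory.Measure (EuclideanSpace ℝ (Fin 3)) → ℝ → ℝ → ℝ → Prop := fun μ R₇ R₈ R₉ => ∀ q : EuclideanSpace ℝ (Fin 3), μ {q} ≠ 0 → ∀ R ε : ℝ, 0 < ε → ∃ (N : ℕ) (y : Fin N → EuclideanSpace ℝ (Fin 3)) (i : Fin N), TexBall N y i R R₇ R₈ R₉ ∧ (∀ p : EuclideanSpace ℝ (Fin 3), μ {p} ≠ 0 → dist p q ≤ R → ∃ k : Fin N, dist (y k - y i) (p - q) ≤ ε) ∧ (∀ k : Fin N, dist (y k) (y i) ≤ R → ∃ p : EuclideanSpace ℝ (Fin 3), μ {p} ≠ 0 ∧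 dist (y k - y i) (p - q) ≤ ε); Literature.Probability.Process.IsRootedHardCore δ μ → Appr μ R₇ R₈ R₉ → (∀ p : EuclideanSpace ℝ (Fin 3), μ {p} ≠ 0 → ∀ y : EuclideanSpace ℝ (Fin 3), (∀ q : EuclideanSpace ℝ (Fin 3), μ {q} ≠ 0 → q ≠ p → y ≠ q) → ∑' q : {q : EuclideanSpace ℝ (Fin 3) // μ {q} ≠ 0 ∧ q ≠ p}, Literature.MathematicalPhysics.StatisticalMechanics.lennardJones (dist p (q : EuclideanSpace ℝ (Fin 3))) ≤ ∑' q : {q : EuclideanSpace ℝ (Fin 3) // μ {q} ≠ 0 ∧ q ≠ p}, Literature.MathematicalPhysics.StatisticalMechanics.lennardJones (dist y (q : EuclideanSpace ℝ (Fin 3)))) → (¬ ∃ Q : Literature.MathematicalPhysics.StatisticalMechanics.PeriodicConfiguration 3, ∃ t : EuclideanSpace ℝ (Fin 3), {p : EuclideanSpace ℝ (Fin 3) | μ {p} ≠ 0} = (fun s => s + t) '' Q.points) → ¬ Literature.MathematicalPhysics.StatisticalMechanics.IsMuGSC Literature.MathematicalPhysics.StatisticalMechanics.lennardJones (⨅ Q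 : Literature.MathematicalPhysics.StatisticalMechanics.PeriodicConfiguration 3, Q.energyPerParticle Literature.MathematicalPhysics.StatisticalMechanics.lennardJones) {p : EuclideanSpace ℝ (Fin 3) | μ {p} ≠ 0}) ↔
    (∀ δ : ℝ, 0 < δ → ∀ R₇ R₈ R₉ : ℝ, ∀ μ : MeasureTheory.Measure (EuclideanSpace ℝ (Fin 3)), let Gy : ℝ → (N : ℕ) → (Fin N → EuclideanSpace ℝ (Fin 3)) → Fin N → Prop := fun η N y j => let d : ℝ := sInf ((fun z => dist z (y (j : Fin N))) '' (Set.range (y) \ {(y (j : Fin N))})); let T : Set (EuclideanSpace ℝ (Fin 3)) := {z : EuclideanSpace ℝ (Fin 3) | z ∈ Set.range (y) ∧ z ≠ (y (j : Fin N)) ∧ dist z (y (j : Fin N)) < 13 / 10 * d}; ∃ A : EuclideanSpace ℝ (Fin 3) →ₗᵢ[ℝ] EuclideanSpace ℝ (Fin 3), (∃ e : ↥T ≃ ↥Literature.Geometry.DiscreteGeometry.fccKissingPattern, ∀ t : ↥T, dist (d⁻¹ • ((t : EuclideanSpace ℝ (Fin 3)) - (y (j : Fin N)))) (A ((e t : ↥Literature.Geometry.DiscreteGeometry.fccKissingPattern)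 : EuclideanSpace ℝ (Fin 3))) ≤ η) ∨ (∃ e : ↥T ≃ ↥Literature.Geometry.DiscreteGeometry.hcpKissingPattern, ∀ t : ↥T, dist (d⁻¹ • ((t : EuclideanSpace ℝ (Fin 3)) - (y (j : Fin N)))) (A ((e t : ↥Literature.Geometry.DiscreteGeometry.hcpKissingPattern) : EuclideanSpace ℝ (Fin 3))) ≤ η); let TexBall : (N : ℕ) → (Fin N → EuclideanSpace ℝ (Fin 3)) → Fin N → ℝ → ℝ → ℝ → ℝ → Prop := fun N y i R R₇ R₈ R₉ => (∀ a b : Fin N, a ≠ b → (7 : ℝ) / 10 ≤ dist (y a) (y b)) ∧ (∀ j : Fin N, dist (y j) (y i) ≤ R → ¬ Gy (1 / 20) N (y) j) ∧ (∀ j : Fin N, dist (y j) (y i) ≤ R → ¬ ((∀ j' : Fin N, dist (y j') (y j) ≤ R₇ → ¬ Gy (1 / 20) N (y) j') ∧ (∀ z : EuclideanSpace ℝ (Fin 3), dist z (y j) ≤ R₇ → ∃ k : Fin N, dist z (y k) ≤ 1) ∧ (∀ j' : Fin N, dist (y j') (y j) ≤ R₇ → (let d : ℝ := sInf ((fun z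 => dist z (y j')) '' (Set.range (y) \ {(y j')})); ∀ k : Fin N, y k ≠ y j' → dist (y k) (y j') < 27 / 20 * d → 5 ≤ Nat.card {m : Fin N // y m ≠ y j' ∧ dist (y m) (y j') < 27 / 20 * d ∧ y m ≠ y k ∧ dist (y m) (y k) < 27 / 20 * d})))) ∧ (∀ j : Fin N, dist (y j) (y i) ≤ R → ∃ k : Fin N, dist (y k) (y j) ≤ R₈ ∧ Gy (1 / 8) N (y) k) ∧ (∀ j : Fin N, dist (y j) (y i) ≤ R → ¬ ((∀ j' : Fin N, dist (y j') (y j) ≤ R₉ → ¬ Gy (1 / 20) N (y) j') ∧ (Nat.card {j' : Fin N // dist (y j') (y j) ≤ R₉ ∧ ¬ Gy (1 / 8) N (y) j'} : ℝ) ≤ 1 / 2 * (Nat.card {j' : Fin N // dist (y j') (y j) ≤ R₉} : ℝ) ∧ (∀ j' : Fin N, dist (y j') (y j) ≤ R₉ → ¬ Gy (1 / 8) N (y) j' → ¬ (let d : ℝ := sInf ((fun z => dist z (y j')) '' (Set.range (y) \ {(y j')})); ∀ k : Fin N, y k ≠ y j' → dist (y k) (y j') < 27 / 20 * d → 5 ≤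 Nat.card {m : Fin N // y m ≠ y j' ∧ dist (y m) (y j') < 27 / 20 * d ∧ y m ≠ y k ∧ dist (y m) (y k) < 27 / 20 * d})))); let Appr : MeasureTheory.Measure (EuclideanSpace ℝ (Fin 3)) → ℝ → ℝ → ℝ → Prop := fun μ R₇ R₈ R₉ => ∀ q : EuclideanSpace ℝ (Fin 3), μ {q} ≠ 0 → ∀ R ε : ℝ, 0 < ε → ∃ (N : ℕ) (y : Fin N → EuclideanSpace ℝ (Fin 3)) (i : Fin N), TexBall N y i R R₇ R₈ R₉ ∧ (∀ p : EuclideanSpace ℝ (Fin 3), μ {p} ≠ 0 → dist p q ≤ R → ∃ k : Fin N, dist (y k - y i) (p - q) ≤ ε) ∧ (∀ k : Fin N, dist (y k) (y i) ≤ R → ∃ p : EuclideanSpace ℝ (Fin 3), μ {p} ≠ 0 ∧ dist (y k - y i) (p - q) ≤ ε); Literature.Probability.Process.IsRootedHardCore δ μ → Appr μ R₇ R₈ R₉ → (¬ ∃ Q : Literature.MathematicalPhysics.StatisticalMechanics.PeriodicConfiguration 3, ∃ t : EuclideanSpace ℝ (Fin 3), {p : EuclideanSpace ℝ (Fin 3)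 | μ {p} ≠ 0} = (fun s => s + t) '' Q.points) → ¬ Literature.MathematicalPhysics.StatisticalMechanics.IsMuGSC Literature.MathematicalPhysics.StatisticalMechanics.lennardJones (⨅ Q : Literature.MathematicalPhysics.StatisticalMechanics.PeriodicConfiguration 3, Q.energyPerParticle Literature.MathematicalPhysics.StatisticalMechanics.lennardJones) {p : EuclideanSpace ℝ (Fin 3) | μ {p} ≠ 0}) := by
  constructor
  · intro hR δ hδ R₇ R₈ R₉ μ
    have h' := hR δ hδ R₇ R₈ R₉ μ
    dsimp only at h' ⊢
    intro hcore happr hper hG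
    exact h' hcore happr (nash_clause_of_isMuGSC hG) hper hG
  · intro hR δ hδ R₇ R₈ R₉ μ
    have h' := hR δ hδ R₇ R₈ R₉ μ
    dsimp only at h' ⊢
    intro hcore happr _hnash hper
    exact h' hcore happr hper

end Summit.AtomisticToContinuum.Crystallization.Theorems.FrustratedLawDichotomyGSCOneAtomTests

end
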